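import Summits.ResolutionOfSingularities.ResolutionOfSingularities.Theorems.FrobeniusLadderFRationalResolutionZModCharacters
import Mathlib.Data.Int.GCD
import Mathlib.Algebra.Group.Hom.Basic
import HarnessLib

/-!
# Crux `FrobeniusLadder.FRationalResolution` (stmt-ResolutionOfSingularities-15317), line `redirect`,
# stub `stub_diagonalizableQuotientResolution` — item (F2c), group-theoretic core: a `ℤ/(nd)`-valued character with PRESCRIBED value
# `d` on an element `b` of prime-power order `n`, and the resulting complement of the root degree in the pushout group

For the multi-root recipe (MEMO-15317-leafhand2-g22): after regrading by `A' = (A × ℤ/(nd))/⟨(b, −d)⟩` and adjoining `w^d = u`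
(`deg u = b`, `n = ord b = ℓ^{e+1}`), the split-off step needs a complement of `⟨a⟩`, `a = [(0,1)]`, in `A'`; it is the graph of
`−s` for an additive `s : A →+ ℤ/(nd)` with `s b = d`.

* `exists_addMonoidHom_zmod_apply_eq` — if `ℓ^e • b ∉ (nd)·A` (true e.g. when `(nd)·A` has no `ℓ`-torsion), there is
  `s : A →+ ZMod (n d)` with `s b = d`: separate the image of `ℓ^e • b` in `A/(nd)A` by a `ℤ/(nd)`-character
  (`…ZModCharacters`), whose value on `b` is then `c • d` with `ℓ ∤ c`; rescale by an inverse of `c` modulo `n`.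
* `nsmul_ne_of_nsmul_eq_zero` — the hypothesis holds as soon as `q • ((nd) • c) = 0` for all `c` with `ℓ ∤ q`
  (e.g. `nd · q = ℓ^{e+1} · |A|`).

Honest label: helper toward ONE leaf stub; no stub, crux or summit closed. No definitions, no named facts, no sorry. [folklore]
-/

noncomputable section

-- single-problem summit: the doubled namespace component is forced
set_option linter.dupNamespace false

namespace Summit.ResolutionOfSingularities.ResolutionOfSingularities.Theorems.FRationalResolution.ZModCharacterPrescribed

/-- **A `ℤ/(nd)`-character with prescribed value on an element of prime-power order.** `A` finite abelian, `b ∈ A` of order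
`n = ℓ^(e+1)` (`ℓ` prime), `d ≥ 1`, and `ℓ^e • b ∉ (nd)·A`: there is `s : A →+ ZMod (n d)` with `s b = d`. [folklore] -/
theorem exists_addMonoidHom_zmod_apply_eq {A : Type} [AddCommGroup A] [Finite A] (ℓ e d : ℕ) (hℓ : ℓ.Prime) [NeZero d]
    (b : A) (hb : addOrderOf b = ℓ ^ (e + 1)) (H : ∀ c : A, (ℓ ^ (e + 1) * d) • c ≠ ℓ ^ e • b) :
    ∃ s : A →+ ZMod (ℓ ^ (e + 1) * d), s b = (d : ZMod (ℓ ^ (e + 1) * d)) := by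
  have hℓ1 : 1 < ℓ := hℓ.one_lt
  have hn1 : 1 < ℓ ^ (e + 1) := Nat.one_lt_pow (Nat.succ_ne_zero e) hℓ1
  haveI : NeZero (ℓ ^ (e + 1) * d) := ⟨Nat.mul_ne_zero (by omega) (NeZero.ne d)⟩
  -- the quotient `G = A/(nd)A`, of exponent dividing `nd`
  let K : AddSubgroup A := (nsmulAddMonoidHom (ℓ ^ (e + 1) * d) : A →+ A).range
  have hexp : AddMonoid.exponent (A ⧸ K) ∣ ℓ ^ (e + 1) * d := by
    refine AddMonoid.exponent_dvd_of_forall_nsmul_eq_zero fun g => ?_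
    obtain ⟨c, rfl⟩ := QuotientAddGroup.mk_surjective g
    rw [← QuotientAddGroup.mk_nsmul, QuotientAddGroup.eq_zero_iff]
    exact ⟨c, nsmulAddMonoidHom_apply _ c⟩
  -- the image of `ℓ^e • b` is nonzero there
  have hx : (QuotientAddGroup.mk (ℓ ^ e • b) : A ⧸ K) ≠ 0 := by
    intro h
    rw [QuotientAddGroup.eq_zero_iff] at h
    obtain ⟨c, hc⟩ := h
    exact H c (by rw [← hc, nsmulAddMonoidHom_apply])
  obtain ⟨sbar, hsbar⟩ := ZModCharacters.exists_addMonoidHom_zmod_apply_ne_zero (ℓ ^ (e + 1) * d) hexp hx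
  let s₀ : A →+ ZMod (ℓ ^ (e + 1) * d) := sbar.comp (QuotientAddGroup.mk' K)
  set y : ZMod (ℓ ^ (e + 1) * d) := s₀ b with hy
  have hy1 : ℓ ^ e • y ≠ 0 := by rw [hy, ← map_nsmul]; exact hsbar
  have hy2 : ℓ ^ (e + 1) • y = 0 := by
    have h : ℓ ^ (e + 1) • b = 0 := by rw [← hb]; exact addOrderOf_nsmul_eq_zero b
    rw [hy, ← map_nsmul, h, map_zero]
  -- `y = c • d` with `ℓ ∤ c`
  have hdvd : d ∣ y.val := by
    have h1 : ((ℓ ^ (e + 1) * y.val : ℕ) : ZMod (ℓ ^ (e + 1) * d)) = 0 := by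
      rw [Nat.cast_mul, ZMod.natCast_zmod_val, ← nsmul_eq_mul, hy2]
    rw [ZMod.natCast_eq_zero_iff] at h1
    exact Nat.dvd_of_mul_dvd_mul_left (by positivity) h1
  obtain ⟨c, hc⟩ := hdvd
  have hyc : y = ((c * d : ℕ) : ZMod (ℓ ^ (e + 1) * d)) := by
    rw [show c * d = y.val by rw [hc, Nat.mul_comm], ZMod.natCast_zmod_val]
  have hℓc : ¬ ℓ ∣ c := by
    rintro ⟨c', rfl⟩
    apply hy1
    rw [hyc, nsmul_eq_mul, ← Nat.cast_mul,
      show ℓ ^ e * (ℓ * c' * d) = c' * (ℓ ^ (e + 1) * d) by ring, Nat.cast_mul, ZMod.natCast_self, mul_zero]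
  have hcop : Nat.Coprime c (ℓ ^ (e + 1)) :=
    (Nat.Coprime.pow_left (e + 1) ((Nat.Prime.coprime_iff_not_dvd hℓ).2 hℓc)).symm
  -- rescale by an inverse of `c` modulo `n`
  obtain ⟨m, -, hm⟩ := Nat.exists_mul_mod_eq_one_of_coprime hcop hn1
  refine ⟨(AddMonoidHom.mulLeft ((m : ℕ) : ZMod (ℓ ^ (e + 1) * d))).comp s₀, ?_⟩
  rw [AddMonoidHom.comp_apply, AddMonoidHom.coe_mulLeft, ← hy, hyc, ← Nat.cast_mul]
  have hcm : m * (c * d) = (c * m / ℓ ^ (e + 1)) * (ℓ ^ (e + 1) * d) + d := by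
    have h := Nat.div_add_mod (c * m) (ℓ ^ (e + 1))
    rw [hm] at h
    calc m * (c * d) = (c * m) * d := by ring
      _ = (ℓ ^ (e + 1) * (c * m / ℓ ^ (e + 1)) + 1) * d := by rw [h]
      _ = (c * m / ℓ ^ (e + 1)) * (ℓ ^ (e + 1) * d) + d := by ring
  rw [hcm, Nat.cast_add, Nat.cast_mul, ZMod.natCast_self, mul_zero, zero_add]

/-- **Discharging the hypothesis.** If some `q` prime to `ℓ` kills `(nd)·A` (e.g. `nd · q = ℓ^{e+1} · |A|`), then
`ℓ^e • b ∉ (nd)·A` for `b` of order `ℓ^{e+1}`. [folklore] -/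
theorem nsmul_ne_of_nsmul_eq_zero {A : Type} [AddCommGroup A] (ℓ e N q : ℕ) (hℓ : ℓ.Prime) (hq : ¬ ℓ ∣ q)
    (hN : ∀ c : A, q • (N • c) = 0) (b : A) (hb : addOrderOf b = ℓ ^ (e + 1)) (c : A) : N • c ≠ ℓ ^ e • b := by
  intro h
  have h1 : q • (ℓ ^ e • b) = 0 := by rw [← h]; exact hN c
  rw [← mul_nsmul, ← addOrderOf_dvd_iff_nsmul_eq_zero, hb, pow_succ] at h1
  exact hq (Nat.dvd_of_mul_dvd_mul_left (pow_pos hℓ.pos e) h1)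

end Summit.ResolutionOfSingularities.ResolutionOfSingularities.Theorems.FRationalResolution.ZModCharacterPrescribed

end
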